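import Mathlib
import HarnessLib
import Summits.CriticalPhenomena.PercolationContinuityZ3.Theses.PercLowPointHalfSpace
import Summits.CriticalPhenomena.PercolationContinuityZ3.Theorems.PercLowPointHalfSpaceLowPointBookkeepingStemTransport
import Summits.CriticalPhenomena.PercolationContinuityZ3.Theorems.PercLowPointHalfSpaceLowPointBookkeepingStemLevelTransports

/-!
# Crux `LowPointBookkeeping` (stmt-CriticalPhenomena-14713), line `SketchIdeator4`: the STEM INEQUALITY
# at one level (registered stub `stub_stemLevel`)

For bond percolation on `ℤ³` at ANY parameter `p`, every `r ≥ 1` and every threshold `t > 0`: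

`P_p(W_r) ≤ t⁻¹ · Σ_{x ∈ B_{2r}, x₀ = r} P_p(0 ↔_ℍ x) + Σ_{x ∈ B_r, x₀ = r} P_p(0 ↔_ℍ x, locFoot_r < t)`,

where `W_r = {r e₀ ↔ ∂ℍ inside r e₀ + [-r, r]³}` is the localised point-to-wall event of the cube exit,
`ℍ = {0 ≤ x₀}`, and `locFoot_r(ω) = #{g ∈ B_r ∩ ∂ℍ | 0 ↔ g inside B_r ∩ ℍ}` is the local footprint of the
wall cluster `U = C_ℍ(0)`.  Proof (card `cube-exit-stem-criterion`, FindingsIdeator4 §1, steps 2–4):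

1. TRANSPORT (`lintegral_W_eq`): send mass `w_r(x) = 1/|F_r(x)|` from the apex `x = u + r e₀` above a floor
   point `u`, on `W_r(x)`, to each of its feet `F_r(x) = {f ∈ ∂ℍ | x ↔ f in Q_{2r}(x) ∩ ℍ}`; the floor
   mass-transport principle (`BoundaryTwoArmDecay.stub_census_floorMTP`, landed) gives
   `P(W_r) = E Σ_u 𝟙_{W_r(x_u)} 𝟙{0 ∈ F_r(x_u)} w_r(x_u)`.
2. SPLIT (`Phi_le`): on `W_r(x)` pick an exit foot `f`; if its local feet `G_r(f)` number `≥ t` then, since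
   `G_r(f) ⊆ F_r(x)` (`Stem.G_subset_F`), the weight is `≤ t⁻¹` (FAT); otherwise the term is one of the
   summands of the THIN transport `Σ_a 𝟙{x ↔ a in Q_r(x)} 𝟙{|G_r(a)| < t} 𝟙{0 ∈ F_r(x)} w_r(x)`.
3. RE-ROOTING (`lintegral_thin_le`): a second floor mass transport moves the thin sum from the receiver `0`
   to the thin foot `a`; the sum over receivers `b` of `𝟙{b ∈ F_r(x)} w_r(x)` is EXACTLY `1`, so the thin part
   is `≤ E[𝟙{|G_r(0)| < t} · #{x ∈ B_r, x₀ = r, 0 ↔_ℍ x}]`; the fat part is `≤ t⁻¹ E #{x ∈ B_{2r}, x₀ = r, 0 ↔_ℍ x}`.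

References: R. Lyons – Y. Peres, *Probability on Trees and Networks* (2016), §8.2; G. Grimmett, *Percolation*
(1999), §1.6.
-/

noncomputable section

open MeasureTheory Filter Topology
open Literature.Probability.Percolation Literature.Probability.LatticeModels
open scoped ENNReal Classical

namespace Summit.CriticalPhenomena.PercolationContinuityZ3.Theorems.StemCriterion

open Summit.CriticalPhenomena.PercolationContinuityZ3.Theses.PercLowPointHalfSpace
open LowPoint (conn_symm conn_trans conn_refl conn_mono)

/-- The shift `ω ↦ ω + s` of bond configurations of `ℤ³` (local notation). -/
local notation3 (prettyPrint := false) "𝑻[" s "]" => BondConfig.relabel (sym2Equiv (Site.shift s))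

/-- The half-space `ℍ = {0 ≤ x₀}` as written in the route file (local notation). -/
local notation3 (prettyPrint := false) "𝐇" => ({x : Site 3 | 0 ≤ x 0} : Set (Site 3))

/-- The sup-norm cube `Q_s(x) = x + [-s, s]³` (local notation). -/
local notation3 (prettyPrint := false) "𝐐[" x ", " s "]" =>
  ({y : Site 3 | ∀ i : Fin 3, |y i - x i| ≤ ((s : ℕ) : ℤ)} : Set (Site 3))

/-- The localised point-to-wall event `W_r(x) = {x ↔ ∂ℍ inside Q_r(x)}` (local notation). -/
local notation3 (prettyPrint := false) "𝐖[" x ", " r "]" =>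
  ({ω : BondConfig (Site 3) | ∃ f : Site 3, f 0 = 0 ∧ ω ∈ openConnIn 𝐐[x, r] x f} : Set (BondConfig (Site 3)))

/-- The feet of `x`: floor points joined to `x` inside `Q_{2r}(x) ∩ ℍ` (local notation). -/
local notation3 (prettyPrint := false) "𝐅[" x ", " r ", " ω "]" =>
  ({f : Site 3 | f 0 = 0 ∧ ω ∈ openConnIn (𝐐[x, 2 * r] ∩ 𝐇) x f} : Set (Site 3))

/-- The local feet of a floor point `a`: floor points joined to `a` inside `Q_r(a) ∩ ℍ` (local notation). -/
local notation3 (prettyPrint := false) "𝐆[" a ", " r ", " ω "]" =>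
  ({g : Site 3 | g 0 = 0 ∧ ω ∈ openConnIn (𝐐[a, r] ∩ 𝐇) a g} : Set (Site 3))

/-- The transport weight `w_r(x) = 1/|F_r(x)|` (local notation). -/
local notation3 (prettyPrint := false) "𝐰[" x ", " r ", " ω "]" =>
  (((Set.encard 𝐅[x, r, ω] : ℕ∞) : ℝ≥0∞))⁻¹

/-- The vertical vector `r e₀` (local notation). -/
local notation3 (prettyPrint := false) "𝐞[" r "]" => (Pi.single 0 ((r : ℕ) : ℤ) : Site 3)

/-- The first transport function: mass `w_r(x)` from the apex `x = u + r e₀`, on `W_r(x)`, to the foot `v`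
(local notation). -/
local notation3 (prettyPrint := false) "𝐟[" r ", " ω ", " u ", " v "]" =>
  Set.indicator (𝐖[u + 𝐞[r], r] ∩ {ω' : BondConfig (Site 3) | v ∈ 𝐅[u + 𝐞[r], r, ω']})
    (fun ω' => 𝐰[u + 𝐞[r], r, ω']) ω

/-- The mass arriving at the origin from the apex above `u` (local notation). -/
local notation3 (prettyPrint := false) "𝚽[" r ", " u ", " ω "]" =>
  Set.indicator ({ω' : BondConfig (Site 3) | u 0 = 0} ∩ (𝐖[u + 𝐞[r], r] ∩
    {ω' : BondConfig (Site 3) | (0 : Site 3) ∈ 𝐅[u + 𝐞[r], r, ω']}))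
    (fun ω' => 𝐰[u + 𝐞[r], r, ω']) ω

/-- The fat indicator `𝟙{u ∈ ∂ℍ, 0 ∈ F_r(u + r e₀)}` (local notation). -/
local notation3 (prettyPrint := false) "𝚩[" r ", " u ", " ω "]" =>
  Set.indicator ({ω' : BondConfig (Site 3) | u 0 = 0} ∩
    {ω' : BondConfig (Site 3) | (0 : Site 3) ∈ 𝐅[u + 𝐞[r], r, ω']}) (1 : BondConfig (Site 3) → ℝ≥0∞) ω

/-- The thin transport summand: mass `w_r(x)` of the apex `x = u + r e₀`, routed through the thin foot `a`
(`x ↔ a` inside `Q_r(x)`, `|G_r(a)| < t`) to the receiver `b ∈ F_r(x)` (local notation). -/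
local notation3 (prettyPrint := false) "𝚿[" r ", " t ", " u ", " a ", " b ", " ω "]" =>
  Set.indicator ({ω' : BondConfig (Site 3) | u 0 = 0 ∧ a 0 = 0} ∩
    (openConnIn 𝐐[u + 𝐞[r], r] (u + 𝐞[r]) a ∩
      ({ω' : BondConfig (Site 3) | ((𝐆[a, r, ω']).ncard : ℝ) < t} ∩
        {ω' : BondConfig (Site 3) | b ∈ 𝐅[u + 𝐞[r], r, ω']})))
    (fun ω' => 𝐰[u + 𝐞[r], r, ω']) ω

namespace Stem

/-! ## The pointwise fat/thin split -/

/-- **The split.**  `𝚽(u) ≤ t⁻¹ · 𝚩(u) + Σ_a 𝚿(u, a, 0)`: on the event of `𝚽(u)` pick an exit foot `f` of the apex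
`x`; if `|G_r(f)| ≥ t` then `w_r(x) ≤ t⁻¹` because `G_r(f) ⊆ F_r(x)`; otherwise the summand `a = f` of the thin
sum is the whole weight. [folklore] -/
theorem Phi_le (r : ℕ) {t : ℝ} (ht : 0 < t) (u : Site 3) (ω : BondConfig (Site 3)) :
    𝚽[r, u, ω] ≤ ENNReal.ofReal t⁻¹ * 𝚩[r, u, ω] + ∑' a : Site 3, 𝚿[r, t, u, a, 0, ω] := by
  by_cases h : ω ∈ {ω' : BondConfig (Site 3) | u 0 = 0} ∩ (𝐖[u + 𝐞[r], r] ∩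
      {ω' : BondConfig (Site 3) | (0 : Site 3) ∈ 𝐅[u + 𝐞[r], r, ω']})
  · obtain ⟨hu, ⟨f, hf0, hf⟩, h0⟩ := h
    have hu' : u 0 = 0 := hu
    rw [Set.indicator_of_mem (show ω ∈ {ω' : BondConfig (Site 3) | u 0 = 0} ∩ (𝐖[u + 𝐞[r], r] ∩
      {ω' : BondConfig (Site 3) | (0 : Site 3) ∈ 𝐅[u + 𝐞[r], r, ω']}) from ⟨hu, ⟨f, hf0, hf⟩, h0⟩)]
    by_cases hthin : ((𝐆[f, r, ω]).ncard : ℝ) < t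
    · refine le_add_left ?_
      refine le_trans (le_of_eq ?_) (ENNReal.le_tsum f)
      rw [Set.indicator_of_mem]
      exact ⟨⟨hu', hf0⟩, hf, hthin, h0⟩
    · refine le_add_right ?_
      rw [Set.indicator_of_mem (show ω ∈ {ω' : BondConfig (Site 3) | u 0 = 0} ∩
        {ω' : BondConfig (Site 3) | (0 : Site 3) ∈ 𝐅[u + 𝐞[r], r, ω']} from ⟨hu, h0⟩), Pi.one_apply, mul_one]
      push Not at hthin
      have hfin := F_finite (u + 𝐞[r]) r ω
      have hsub := G_subset_F (apex_level hu' r) hf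
      have hn : t ≤ ((𝐅[u + 𝐞[r], r, ω]).ncard : ℝ) :=
        hthin.trans (by exact_mod_cast Set.ncard_le_ncard hsub hfin)
      have hnpos : (0 : ℝ) < ((𝐅[u + 𝐞[r], r, ω]).ncard : ℝ) := ht.trans_le hn
      rw [← hfin.cast_ncard_eq, ENat.toENNReal_coe, ← ENNReal.ofReal_natCast,
        ← ENNReal.ofReal_inv_of_pos hnpos]
      exact ENNReal.ofReal_le_ofReal (inv_anti₀ ht hn)
  · rw [Set.indicator_of_notMem h]
    exact zero_le

/-! ## The fat part -/

/-- **Fat part**: `Σ_u 𝚩(u) ≤ Σ_{x ∈ B_{2r}, x₀ = r} 𝟙{0 ↔_ℍ x}` (a foot at the origin makes `x` a point of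
`U ∩ L_r ∩ B_{2r}`). [folklore] -/
theorem tsum_B_le (r : ℕ) (ω : BondConfig (Site 3)) :
    ∑' u : Site 3, 𝚩[r, u, ω] ≤ ∑ x ∈ (box 3 (2 * r)).filter (fun x : Site 3 => x 0 = (r : ℤ)),
      (openConnIn 𝐇 0 x).indicator 1 ω := by
  refine tsum_le_sum_of_apex (h := fun u : Site 3 => 𝚩[r, u, ω])
    (c := fun x : Site 3 => (openConnIn 𝐇 0 x).indicator 1 ω) 𝐞[r] (fun u hu => ?_) (fun x _ => ?_)
  · obtain ⟨hu0, h0⟩ : ω ∈ {ω' : BondConfig (Site 3) | u 0 = 0} ∩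
        {ω' : BondConfig (Site 3) | (0 : Site 3) ∈ 𝐅[u + 𝐞[r], r, ω']} := by
      by_contra hc
      exact hu (Set.indicator_of_notMem hc _)
    exact Finset.mem_filter.2 ⟨(conn_H_of_zero_mem_F h0).2, apex_level hu0 r⟩
  · rw [sub_add_cancel]
    by_cases h : ω ∈ {ω' : BondConfig (Site 3) | (x - 𝐞[r]) 0 = 0} ∩
        {ω' : BondConfig (Site 3) | (0 : Site 3) ∈ 𝐅[x, r, ω']}
    · rw [Set.indicator_of_mem h, Set.indicator_of_mem (conn_H_of_zero_mem_F h.2).1]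
    · rw [Set.indicator_of_notMem h]
      exact zero_le

/-- Measurability of `𝚩(u)`. [folklore] -/
theorem measurable_B (r : ℕ) (u : Site 3) : Measurable fun ω : BondConfig (Site 3) => 𝚩[r, u, ω] :=
  measurable_one.indicator ((MeasurableSet.const _).inter (measurableSet_mem_F _ 0 r))

/-! ## Assembly -/

/-- **The stem inequality in `ℝ≥0∞`** (apex written `0 + r e₀`). [folklore] -/
theorem measure_W_le (p : unitInterval) (r : ℕ) {t : ℝ} (ht : 0 < t) :
    bondPercolation (zdGraph 3) p 𝐖[(0 : Site 3) + 𝐞[r], r] ≤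
      ENNReal.ofReal t⁻¹ * ∑ x ∈ (box 3 (2 * r)).filter (fun x : Site 3 => x 0 = (r : ℤ)),
          bondPercolation (zdGraph 3) p (openConnIn 𝐇 0 x) +
        ∑ x ∈ (box 3 r).filter (fun x : Site 3 => x 0 = (r : ℤ)), bondPercolation (zdGraph 3) p
          ({ω' : BondConfig (Site 3) | ((𝐆[(0 : Site 3), r, ω']).ncard : ℝ) < t} ∩ openConnIn 𝐇 0 x) := by
  set P := bondPercolation (zdGraph 3) p with hP
  have hmB : Measurable fun ω : BondConfig (Site 3) => ∑' u : Site 3, 𝚩[r, u, ω] :=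
    Measurable.tsum fun u => measurable_B r u
  calc P 𝐖[(0 : Site 3) + 𝐞[r], r] = ∫⁻ ω, ∑' u : Site 3, 𝚽[r, u, ω] ∂P := lintegral_W_eq p r
    _ ≤ ∫⁻ ω, ENNReal.ofReal t⁻¹ * ∑' u : Site 3, 𝚩[r, u, ω] +
          ∑' u : Site 3, ∑' a : Site 3, 𝚿[r, t, u, a, 0, ω] ∂P := by
        refine lintegral_mono fun ω => ?_
        calc ∑' u : Site 3, 𝚽[r, u, ω]
            ≤ ∑' u : Site 3, (ENNReal.ofReal t⁻¹ * 𝚩[r, u, ω] + ∑' a : Site 3, 𝚿[r, t, u, a, 0, ω]) :=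
              ENNReal.tsum_le_tsum fun u => Phi_le r ht u ω
          _ = _ := by rw [ENNReal.tsum_add, ENNReal.tsum_mul_left]
    _ = ENNReal.ofReal t⁻¹ * ∫⁻ ω, ∑' u : Site 3, 𝚩[r, u, ω] ∂P +
          ∫⁻ ω, ∑' u : Site 3, ∑' a : Site 3, 𝚿[r, t, u, a, 0, ω] ∂P := by
        rw [lintegral_add_left (hmB.const_mul _), lintegral_const_mul _ hmB]
    _ ≤ ENNReal.ofReal t⁻¹ * ∑ x ∈ (box 3 (2 * r)).filter (fun x : Site 3 => x 0 = (r : ℤ)),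
            P (openConnIn 𝐇 0 x) +
          ∑ x ∈ (box 3 r).filter (fun x : Site 3 => x 0 = (r : ℤ)),
            P ({ω' : BondConfig (Site 3) | ((𝐆[(0 : Site 3), r, ω']).ncard : ℝ) < t} ∩ openConnIn 𝐇 0 x) := by
        refine add_le_add (mul_le_mul_right ?_ _) (lintegral_thin_le p r t)
        calc ∫⁻ ω, ∑' u : Site 3, 𝚩[r, u, ω] ∂P
            ≤ ∫⁻ ω, ∑ x ∈ (box 3 (2 * r)).filter (fun x : Site 3 => x 0 = (r : ℤ)),
                (openConnIn 𝐇 0 x).indicator 1 ω ∂P := lintegral_mono fun ω => tsum_B_le r ω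
          _ = _ := by
              rw [lintegral_finsetSum _ fun x _ =>
                measurable_one.indicator (measurableSet_openConnIn_of_countable _ _ _)]
              exact Finset.sum_congr rfl fun x _ =>
                lintegral_indicator_one (measurableSet_openConnIn_of_countable _ _ _)

/-- **The stem inequality, real form** with the local footprint written as in the stub. [folklore] -/
theorem measureReal_W_le (p : unitInterval) (r : ℕ) {t : ℝ} (ht : 0 < t) :
    (bondPercolation (zdGraph 3) p).real 𝐖[𝐞[r], r] ≤
      t⁻¹ * ∑ x ∈ (box 3 (2 * r)).filter (fun x : Site 3 => x 0 = (r : ℤ)),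
          (bondPercolation (zdGraph 3) p).real (openConnIn 𝐇 0 x) +
        ∑ x ∈ (box 3 r).filter (fun x : Site 3 => x 0 = (r : ℤ)), (bondPercolation (zdGraph 3) p).real
          (openConnIn 𝐇 0 x ∩ {ω | ((((box 3 r).filter fun g : Site 3 =>
            g 0 = 0 ∧ ω ∈ openConnIn ((↑(box 3 r) : Set (Site 3)) ∩ 𝐇) 0 g).card : ℕ) : ℝ) < t}) := by
  set P := bondPercolation (zdGraph 3) p with hP
  have h := measure_W_le p r ht
  rw [zero_add] at h
  have hset : ∀ x : Site 3, ({ω' : BondConfig (Site 3) | ((𝐆[(0 : Site 3), r, ω']).ncard : ℝ) < t} ∩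
      openConnIn 𝐇 0 x) = openConnIn 𝐇 0 x ∩ {ω | ((((box 3 r).filter fun g : Site 3 =>
        g 0 = 0 ∧ ω ∈ openConnIn ((↑(box 3 r) : Set (Site 3)) ∩ 𝐇) 0 g).card : ℕ) : ℝ) < t} := by
    intro x
    rw [Set.inter_comm]
    simp only [ncard_G_zero]
  simp only [hset] at h
  have hfin : ENNReal.ofReal t⁻¹ * ∑ x ∈ (box 3 (2 * r)).filter (fun x : Site 3 => x 0 = (r : ℤ)),
        P (openConnIn 𝐇 0 x) +
      ∑ x ∈ (box 3 r).filter (fun x : Site 3 => x 0 = (r : ℤ)), P (openConnIn 𝐇 0 x ∩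
        {ω | ((((box 3 r).filter fun g : Site 3 =>
          g 0 = 0 ∧ ω ∈ openConnIn ((↑(box 3 r) : Set (Site 3)) ∩ 𝐇) 0 g).card : ℕ) : ℝ) < t}) ≠ ⊤ := by
    refine ENNReal.add_ne_top.2 ⟨ENNReal.mul_ne_top ENNReal.ofReal_ne_top ?_, ?_⟩ <;>
      exact ENNReal.sum_ne_top.2 fun x _ => measure_ne_top _ _
  have h' := ENNReal.toReal_mono hfin h
  rw [ENNReal.toReal_add (ENNReal.mul_ne_top ENNReal.ofReal_ne_top
      (ENNReal.sum_ne_top.2 fun x _ => measure_ne_top _ _)) (ENNReal.sum_ne_top.2 fun x _ => measure_ne_top _ _),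
    ENNReal.toReal_mul, ENNReal.toReal_ofReal (inv_nonneg.2 ht.le),
    ENNReal.toReal_sum (fun x _ => measure_ne_top _ _), ENNReal.toReal_sum (fun x _ => measure_ne_top _ _)] at h'
  simpa only [measureReal_def] using h'

end Stem

/-! ## Registered form -/

open Stem in
/-- **Registered stub `stub_stemLevel`** (crux stmt-CriticalPhenomena-14713, line SketchIdeator4): the per-level
stem inequality `P_p(W_r) ≤ t⁻¹ · Σ_{x ∈ B_{2r}, x₀ = r} P_p(0 ↔_ℍ x) + Σ_{x ∈ B_r, x₀ = r} P_p(0 ↔_ℍ x,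
locFoot_r < t)` for every `p`, `r ≥ 1`, `t > 0`, verbatim the registered signature. [folklore] -/
theorem stub_stemLevel : ∀ (p : unitInterval) (r : ℕ), 1 ≤ r → ∀ t : ℝ, 0 < t → (bondPercolation (zdGraph 3) p).real {ω | ∃ f : Site 3, f 0 = 0 ∧ ω ∈ openConnIn {y : Site 3 | ∀ i : Fin 3, |y i - (Pi.single 0 (r : ℤ) : Site 3) i| ≤ (r : ℤ)} (Pi.single 0 (r : ℤ) : Site 3) f} ≤ t⁻¹ * ∑ x ∈ (box 3 (2 * r)).filter (fun x : Site 3 => x 0 = (r : ℤ)), (bondPercolation (zdGraph 3) p).real (openConnIn {x : Site 3 | 0 ≤ x 0} 0 x) + ∑ x ∈ (box 3 r).filter (fun x : Site 3 => x 0 = (r : ℤ)), (bondPercolation (zdGraph 3) p).real (openConnIn {x : Site 3 | 0 ≤ x 0} 0 x ∩ {ω | ((((box 3 r).filter fun g : Site 3 => g 0 = 0 ∧ ω ∈ openConnIn ((↑(box 3 r) : Set (Site 3)) ∩ {x : Site 3 | 0 ≤ x 0}) 0 g).card : ℕ) : ℝ) < t}) :=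
  fun p r _ _ ht => measureReal_W_le p r ht

end Summit.CriticalPhenomena.PercolationContinuityZ3.Theorems.StemCriterion

end
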